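import Mathlib
import HarnessLib
import Summits.NavierStokesRegularity.NavierStokesRegularity.Theses.PoloidalWindowDoor
import Summits.NavierStokesRegularity.NavierStokesRegularity.Theorems.PoloidalWindowDoorPoloidalWindowRigiditySharper
import Summits.NavierStokesRegularity.NavierStokesRegularity.Theorems.PoloidalWindowDoorPoloidalWindowRigidityK2OfLrcSpatial
import Summits.NavierStokesRegularity.NavierStokesRegularity.Theorems.PoloidalWindowDoorPoloidalWindowRigidityHorizontalFlatPast
import Summits.NavierStokesRegularity.NavierStokesRegularity.Theorems.PoloidalWindowDoorPoloidalWindowRigidityTimeShearLiminf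
import Summits.NavierStokesRegularity.NavierStokesRegularity.Theorems.PoloidalWindowDoorPoloidalWindowRigidityStubUntwisted
import Summits.NavierStokesRegularity.NavierStokesRegularity.Theorems.PoloidalWindowDoorPoloidalWindowRigidityThmAThreeStubs
import Summits.NavierStokesRegularity.NavierStokesRegularity.Theorems.PoloidalWindowDoorPoloidalWindowRigidityThmARelocation


/-!
# Crux K2 `PoloidalWindowRigidity` — line `string_shells` (ns-idea-8 g0, LINE 2, lens «barrier», (TH) column by its GLOBAL HEIGHT PROFILE)

**NS regularity is NOT proved by this file.**  It is a registered skeleton LINE for ONE crux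
(`Summit.NavierStokesRegularity.NavierStokesRegularity.Theses.PoloidalWindowDoor.PoloidalWindowRigidity`, item
stmt-NavierStokesRegularity-19708): six `sorry`-stubs (two of them SHARED verbatim with `Lines/mixed_type.lean` for the thick
columns, one kinematic continuation lemma, one rung) and a kernel-checked composition concluding the crux BY NAME.

## The line in one paragraph

Every registered attack on the hyperbolic time–height column (TH) is LOCAL IN HEIGHT (a window, a jet, a finite spectrum at one
height) or a symmetric ansatz.  The lever here is the GLOBAL HEIGHT PROFILE of the slope law.  (1) `stub_thGlobalLaw`: by real
analyticity of class slices the (TH) slope law `∂_z v_h = m(t,z) ∇ₕw`, known on the window, holds on ALL of space–time in ratio form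
(`∂_z v_b(y)·∂_{b'}w(y') = ∂_z v_{b'}(y')·∂_b w(y)` whenever `y₂ = y'₂`).  Hence at a window time every height is of exactly one
type — hyperbolic (`m<0`), elliptic (`m>0`), TURNING (`∂_z v_h ≡ 0` on the plane) or FLAT (`∇ₕw ≡ 0` on the plane) — and the
composition splits on «some height carries no strictly hyperbolic point» (`stub_turningHeightTH`, the Tricomi/turning-plane
residue = census D9's Sub_S transposed from the thick to the (TH) column, where it is at least a statement about whole PLANES) versus
«every height has a strictly hyperbolic point» (`stub_stringShellsTH`, the deciding stub).  (2) On a globally hyperbolic (TH) slab the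
kinematic identity `w_zz + m Δₕ w = 0` (x_h-INDEPENDENT coefficient) says that every horizontal Fourier mode of the bounded slice
`w(t,·,z)` solves ONE Sturm–Liouville / Krein STRING equation in the height, `Y'' + |ξ|²|m(t,z)| Y = 0`, so the whole slab is generated
from two plane distributions `(ŵ₀, ŵ₁)` by the string propagators `𝒞_z(|ξ|), 𝒮_z(|ξ|)`; boundedness of `w` at ALL heights then kills
every mode on a degenerating string (`∫(1+|z|)|m| < ∞` at an end: modes are asymptotically affine, the vertical end profile is
z-independent hence a bounded ancient 2-D mild solution hence `0` (KNSS 2-D), and the transition matrix to the affine basis is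
invertible — this is the RUNG `stub_shortStringTH`, implied by the line, (M)-load-bearing: the self-similar dressing of a two-mode
Neumann-string profile satisfies every other binder and is singular); on a long tame string (`|m| → m_± > 0`) the Liouville–Green
asymptotics `Y_ξ ≈ |m|^{-1/4}(γ(ξ)e^{i|ξ|s(z)} + c.c.)`, `s = ∫√|m|`, read the class momentum normal form (E) — whose coefficients
are x_h-independent on (TH), tree `…TimeHeightShearLinearSlice` — at each output frequency `ζ = ξ+η` along `s → ∞`: a quadratic pair is
RESONANT with the mode `ζ` (height phase `|ξ| ± |η| = ±|ζ|`) iff `ξ, η, ζ` are COLLINEAR (triangle equality; the non-resonant level sets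
are the confocal ELLIPSES / HYPERBOLAS with foci `0, ζ` — the «shells»).  The CONTINUOUS part of the spectrum disperses along the height
(Riemann–Lebesgue on the fibres `{ξ+η=ζ}`), so asymptotically each mode obeys the LINEAR string–heat law, whose backward growth
`e^{(1+|m₊|)|ζ|²(t₀−t)}` is incompatible with an ancient Besicovitch-bounded amplitude ⇒ the slices have PURE POINT spectrum; ATOMS keep an
exact shell-by-shell bookkeeping with symbol `i(1−m)(|ξ|+|η|)(1−ξ̂·η̂) − m_z|m|^{-1/2}` (imaginary part `> 0` off collinear pairs: Theorem E's
diagonal cancellation explained), and the extreme cross pair of two populated lines is alone on its shell ⇒ all atoms on ONE line ⇒ `w`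
one-dimensional in `x_h`, i.e. UNTWISTED — contradiction (v1's «ellipse-Radon uniqueness» is NOT needed; v2).
The wild-profile residue (oscillatory `m(t,·)` at both ends, no Liouville–Green regime) is named, not hidden.  (3) The thick columns are
discharged by `mixed_type`'s registered stubs, restated verbatim (`stub_hyperbolicThick`, `stub_semiEllipticThick`): this line
re-cuts ONLY the (TH) column.

Composition: `stub_thGlobalLaw` + (`stub_stringShellsTH` | `stub_turningHeightTH`) ⇒ `hH`; shared thick stubs ⇒ `hHT`, `hST`;
tree theorem `…ThmAThreeStubs.twisting_regular_of_three` ⇒ `lrc_jet`'s `stub_twisting` ⇒ (`mixed_type` v2 chain: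
`…StubUntwisted.stub_untwisted`, `…K2OfLrcSpatial`, `…TimeShearLiminf`, `…HorizontalFlatPast`, `…Sharper`) ⇒
`PoloidalWindowRigidity_of_stringShells : …PoloidalWindowRigidity`.  The rung is certified a special case:
`shortStringTH_of_line : stub_thGlobalLaw → stub_stringShellsTH → stub_turningHeightTH → stub_shortStringTH` (proved).
`lean check`: sorries ONLY in the six `stub_*`.

Disproof used: every stub keeps the class binders VERBATIM ((M) Oseen identity, Type-I rate, poloidality, ND pins, (TV)-pin, twist,
hyperbolicity, slope law) — none is an instance of `poloidalWindowRigidity_false_without_mild`, `twistingTH_false_without_mild`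
(K-47 `twistProfile`: (M)-free; here (M) enters through KNSS-2D on the vertical end and through (E) in the shell identity),
`hyperbolicThick_/semiEllipticThick_false_without_mild` (thick stubs verbatim = mixed_type's, same status),
`LocalTHEmpty[NUG]FalseWithoutSlopeGradient` (pins, twist and the slope-gradient (TV)-pin kept), LogTwistGerm `*_false_without_momentum`.
`stub_thGlobalLaw` minus (M) is false (a C^∞ non-analytic modification off the window), so (M) ⇒ analyticity is load-bearing there too.
Card: `Lines/string_shells.md`.
-/

set_option linter.dupNamespace false
set_option linter.unusedVariables false

namespace Summit.NavierStokesRegularity.NavierStokesRegularity.Cruxes.PoloidalWindowRigidity.StringShells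

open Set Function Metric
open scoped RealInnerProductSpace InnerProductSpace Topology
open Literature.Analysis Literature.Analysis.FluidPDE
open Summit.NavierStokesRegularity.NavierStokesRegularity.Theorems.PoloidalWindowDoorPoloidalWindowRigiditySharper
open Summit.NavierStokesRegularity.NavierStokesRegularity.Theorems.PoloidalWindowDoorPoloidalWindowRigidityK2OfLrcSpatial
open Summit.NavierStokesRegularity.NavierStokesRegularity.Theorems.PoloidalWindowDoorPoloidalWindowRigidityHorizontalFlatPast
open Summit.NavierStokesRegularity.NavierStokesRegularity.Theorems.PoloidalWindowDoorPoloidalWindowRigidityThmAThreeStubs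
open Summit.NavierStokesRegularity.NavierStokesRegularity.Theorems.PoloidalWindowDoorPoloidalWindowRigidityThmARelocation


/-! ### The registered stubs -/

/-- **STUB (`stub_thGlobalLaw`) — analytic continuation of the (TH) slope law to all heights and times (kinematic, M-sized).**
On the window the slope law `∂_z v_b = m(t,z)·∂_b w` (`b = 0,1`) holds; class slices are real-analytic in space–time (bounded mild
ancient solutions), so the polynomial identity `R(s,y,y') := ∂_z v_b(s,y)·∂_{b'}w(s,y') − ∂_z v_{b'}(s,y')·∂_b w(s,y) = 0`, which holds
for same-height pairs of window points, holds for ALL `s < 0` and all same-height pairs (the set `{y₂ = y'₂}` is connected).  This is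
the slope law in RATIO FORM, free of the partial function `m`.  Why it might fail: only if space–time analyticity of class profiles is
not available in the tree yet (then: spatial analyticity at the window times + time-analyticity, or restrict the conclusion to window
times).  Minus (M) it is false (C^∞ bump modification away from `W`). -/
theorem stub_thGlobalLaw :
    ∀ (C : ℝ) (v : ℝ → EuclideanSpace ℝ (Fin 3) → EuclideanSpace ℝ (Fin 3)),
      Literature.Analysis.FluidPDE.HasTypeITimeDecay C v →
      ContinuousOn (Function.uncurry v) (Set.Iio (0 : ℝ) ×ˢ Set.univ) →
      (∀ s t : ℝ, s < t → t < 0 → ∀ x, v t x =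
        Literature.Analysis.UnboundedOperators.heatExtension (v s) (t - s) x -
          Literature.Analysis.FluidPDE.oseenDuhamel 1 s v v t x) →
      (∀ t < 0, Literature.Analysis.FluidPDE.VectorCalculus.IsDivFree (v t)) →
      ∀ W : Set (ℝ × EuclideanSpace ℝ (Fin 3)), IsOpen W → W.Nonempty → W ⊆ Set.Iio (0 : ℝ) ×ˢ Set.univ →
        (∃ m : ℝ → ℝ → ℝ, ∀ z ∈ W, ∀ b : Fin 3, b ≠ 2 →
          fderiv ℝ (v z.1) z.2 (EuclideanSpace.single 2 1) b =
            m z.1 (z.2 2) * fderiv ℝ (v z.1) z.2 (EuclideanSpace.single b 1) 2) →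
        ∀ s : ℝ, s < 0 → ∀ y y' : EuclideanSpace ℝ (Fin 3), y 2 = y' 2 → ∀ b b' : Fin 3, b ≠ 2 → b' ≠ 2 →
          fderiv ℝ (v s) y (EuclideanSpace.single 2 1) b * fderiv ℝ (v s) y' (EuclideanSpace.single b' 1) 2 =
            fderiv ℝ (v s) y' (EuclideanSpace.single 2 1) b' * fderiv ℝ (v s) y (EuclideanSpace.single b 1) 2 := by
  sorry

/-- **STUB (`stub_shortStringTH`) — THE RUNG (a special case implied by the line, see `shortStringTH_of_line`; paper-complete).**
Binders of `mixed_type`'s `stub_hyperbolicTH` verbatim, plus: the slope law holds globally with a slope FUNCTION `m(s,z)` and the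
string is SHORT at the top end at every time, `∫_0^∞ (1+z)|m(s,z)| dz < ∞`.  Proof on paper: the horizontal Fourier modes of the bounded
slice solve `Y'' + |ξ|²|m|Y = 0` (hyperbolic heights) / `Y'' − |ξ|² m Y = 0` in general — for a short string every solution is
asymptotically affine `P(ξ) + zQ(ξ) + o(1)` with an invertible, `ξ`-smooth transition matrix from the basis at a base height;
boundedness gives `Q = 0`; the vertical end profile (class compactness) is z-independent or a shear at every time, and analyticity in
time makes one alternative global, so it is a bounded ancient 2-D mild solution or an ancient bounded caloric shear — constant (KNSS
2009, 2-D; Widder), hence `0` by the Type-I rate; so `P = 0`, hence `ŵ₀ = ŵ₁ = 0` off `ξ = 0`, every slice of `w` is constant in `x_h`,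
contradicting the ND pins on `W`.  (M) is load-bearing: the self-similar dressing `(−t)^{-1/2}V(x/√(−t))` of a two-mode Neumann-string
kinematic profile `V` (modes `Y_j(z)e^{iξ_j·x}`, `|ξ₁| ≠ |ξ₂|` two Neumann eigenvalues of a compactly supported string, non-collinear
`ξ_j`) satisfies every other binder and is singular at the origin.  Why it might fail: only the Lean weight (tempered Fourier transform
of bounded slices on `ℝ²`, ODE asymptotics uniform in the spectral parameter); mathematically the weakest point is the passage
«every vertical end profile vanishes ⇒ `ŵ(s,·,z) → 0` in `𝒮'`», which needs local-uniform convergence along the full limit `z → ∞`. -/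
theorem stub_shortStringTH :
    ∀ (C : ℝ) (v : ℝ → EuclideanSpace ℝ (Fin 3) → EuclideanSpace ℝ (Fin 3)),
      Literature.Analysis.FluidPDE.HasTypeITimeDecay C v →
      ContinuousOn (Function.uncurry v) (Set.Iio (0 : ℝ) ×ˢ Set.univ) →
      (∀ s t : ℝ, s < t → t < 0 → ∀ x, v t x =
        Literature.Analysis.UnboundedOperators.heatExtension (v s) (t - s) x -
          Literature.Analysis.FluidPDE.oseenDuhamel 1 s v v t x) →
      (∀ t < 0, Literature.Analysis.FluidPDE.VectorCalculus.IsDivFree (v t)) →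
      (∀ s < 0, ∀ y, ⟪Literature.Analysis.FluidPDE.curl (v s) y, EuclideanSpace.single 2 1⟫_ℝ = 0) →
      ∀ W : Set (ℝ × EuclideanSpace ℝ (Fin 3)), IsOpen W → W.Nonempty → W ⊆ Set.Iio (0 : ℝ) ×ˢ Set.univ →
        (∀ z ∈ W, Literature.Analysis.FluidPDE.curl (v z.1) z.2 ≠ 0 ∧
          (fderiv ℝ (v z.1) z.2 (EuclideanSpace.single 0 1) 2 ≠ 0 ∨ fderiv ℝ (v z.1) z.2 (EuclideanSpace.single 1 1) 2 ≠ 0) ∧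
          (fderiv ℝ (v z.1) z.2 (EuclideanSpace.single 2 1) 0 ≠ 0 ∨ fderiv ℝ (v z.1) z.2 (EuclideanSpace.single 2 1) 1 ≠ 0)) →
        (∀ m : ℝ → ℝ, ∀ W₁ : Set (ℝ × EuclideanSpace ℝ (Fin 3)), W₁ ⊆ W → IsOpen W₁ → W₁.Nonempty →
          ∃ z ∈ W₁, ∃ b : Fin 3, b ≠ 2 ∧
            fderiv ℝ (v z.1) z.2 (EuclideanSpace.single 2 1) b ≠
              m z.1 * fderiv ℝ (v z.1) z.2 (EuclideanSpace.single b 1) 2) →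
        (∀ z ∈ W,
          fderiv ℝ (fun x => fderiv ℝ (v z.1) x (EuclideanSpace.single 2 1) 2) z.2 (EuclideanSpace.single 0 1) *
              fderiv ℝ (v z.1) z.2 (EuclideanSpace.single 1 1) 2 -
            fderiv ℝ (fun x => fderiv ℝ (v z.1) x (EuclideanSpace.single 2 1) 2) z.2 (EuclideanSpace.single 1 1) *
              fderiv ℝ (v z.1) z.2 (EuclideanSpace.single 0 1) 2 ≠ 0) →
        (∀ z ∈ W,
          fderiv ℝ (v z.1) z.2 (EuclideanSpace.single 2 1) 0 * fderiv ℝ (v z.1) z.2 (EuclideanSpace.single 0 1) 2 +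
            fderiv ℝ (v z.1) z.2 (EuclideanSpace.single 2 1) 1 * fderiv ℝ (v z.1) z.2 (EuclideanSpace.single 1 1) 2 < 0) →
        (∃ m : ℝ → ℝ → ℝ, ∀ z ∈ W, ∀ b : Fin 3, b ≠ 2 →
          fderiv ℝ (v z.1) z.2 (EuclideanSpace.single 2 1) b =
            m z.1 (z.2 2) * fderiv ℝ (v z.1) z.2 (EuclideanSpace.single b 1) 2) →
        (∃ m : ℝ → ℝ → ℝ,
          (∀ s : ℝ, s < 0 → ∀ y : EuclideanSpace ℝ (Fin 3), ∀ b : Fin 3, b ≠ 2 →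
            fderiv ℝ (v s) y (EuclideanSpace.single 2 1) b = m s (y 2) * fderiv ℝ (v s) y (EuclideanSpace.single b 1) 2) ∧
          (∀ s : ℝ, s < 0 → MeasureTheory.IntegrableOn (fun h : ℝ => (1 + |h|) * m s h) (Set.Ioi (0 : ℝ)))) →
        ¬ Literature.Analysis.FluidPDE.IsBackwardSingularPoint v 0 := by
  sorry

/-- **STUB (`stub_stringShellsTH`) — THE DECIDING STUB of the (TH) column on this line: a globally hyperbolic (TH) slab carries no
twisting window.**  Binders of `stub_hyperbolicTH` verbatim + the global ratio law (conclusion of `stub_thGlobalLaw`) + «at every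
window time, every height has a strictly hyperbolic point» (so, by the ratio law, `m(t,z) < 0` is a genuine function on ALL of `ℝ` and
every Fourier mode of `w(t,·,z)` solves the string equation `Y'' + |ξ|²|m(t,z)|Y = 0` on the whole line).  Mechanism: (a) degenerate
ends (`|m|` integrable with first moment, or `|m| → 0` non-integrably so that Liouville–Green amplitudes `|m|^{-1/4}` blow up) carry no
bounded modes — the rung's ODE argument; (b) a long TAME end (`m(t,z) → m_+(t) < 0`, `∂_z m` integrable): Liouville–Green
`Y_ξ ≈ |m|^{-1/4}(γ(ξ)e^{i|ξ|s} + c.c.)`, `s = ∫√|m|`; boundedness of `w_t` kills the secular term (`∂_t m_+ = 0`); the class momentum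
normal form (E) `(1−m)[w_t + ∇ₕf·∇ₕw + w w_z − Δw] = ½ m_z w² − (m_zz − m_t − a_z) w − (2m_z − a) w_z − (β_z − a_t + a_zz)` has
x_h-independent coefficients (tree `…TimeHeightShearLinearSlice`), so at output frequency `ζ = ξ+η` its quadratic terms carry the
height phases `e^{i(|ξ|±|η|)s}` and are RESONANT with the mode `ζ` (phase `e^{±i|ζ|s}`, where ALL linear terms sit) iff `ξ, η, ζ` are
COLLINEAR (triangle equality).  (b′) The CONTINUOUS part of the horizontal spectrum DISPERSES along the height: for a.e. `ζ` the quadratic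
terms are oscillatory integrals over the fibre `{ξ+η = ζ}` whose phase gradients vanish only on the null collinear set, so they tend to `0`
as `s → ∞` (Riemann–Lebesgue; Wiener/Cesàro for a singular-continuous part) while every linear term is an explicit `O(1)` multiple of the
mode — hence on a tame end each mode obeys the LINEAR string–heat law `(1−m₊)[∂_t + i|ζ|θ'(t) + (1+|m₊|)|ζ|²]γ_± = (i a₊|m₊|^{1/2}|ζ| − c₊)γ_±`
with `c₊ = lim_z a_z/(…) = 0` because `a` is bounded (Type-I); backward in time `|γ_±(t,ζ)|` then grows like `e^{(1+|m₊|)|ζ|²(t₀−t)}`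
against the Besicovitch bound `∫|γ_±(t,·)|² ≲ sup|w(t)|² ≤ C²/(−t)` ⇒ `γ_± = 0` a.e.; by the exact string propagator (invertible,
`|ζ|`-smooth transition matrix) the continuous part of `(ŵ₀, ŵ₁)` vanishes: EVERY slice has PURE POINT horizontal spectrum.  (b″) ATOMS do
not disperse and their bookkeeping is exact: non-resonant pair contributions must cancel shell by shell (`ζ`, `ν = |ξ|±|η| ≠ |ζ|`: the
confocal ellipse / hyperbola with foci `0, ζ` through the pair), with Liouville–Green symbol `B = i(1−m)(|ξ|+|η|)(1 − ξ̂·η̂) − m_z|m|^{-1/2}`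
whose imaginary part — the self-advection, cancelling exactly on collinear same-sense pairs (Theorem E's diagonal cancellation explained) —
is `> 0` on every non-collinear pair since `m < 0`; if two distinct lines through `0` are populated, the pair of atoms extreme in a generic
direction is ALONE on its shell ⇒ `B γ(ξ)γ(η) = 0` ⇒ contradiction; so all atoms lie on ONE line: `w` is one-dimensional in `x_h`, the
leaves are parallel lines at every height, the twist vanishes — contradiction with `htw` (equivalently: `v` is a bounded ancient 2½-D mild
flow, constant by the KNSS planar + scalar Liouville theorems).  Finite atom sets are exactly Theorem E's sector; NO ellipse-Radon
uniqueness is needed.  Why it might fail: WILD height profiles (`m(t,·)` oscillatory at both ends: Floquet/quasi-periodic strings — no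
Liouville–Green regime, bounded modes only on the string's spectrum) are a genuine residue (the bet: a class profile's vertical ends are
frozen-slope class objects, tame or degenerate); technical seams: commuting the `s → ∞` asymptotics with `∂_t` (uniform LG on compact
`|ζ|`-ranges away from `0`, the `ζ → 0` corner), singular-continuous spectra (Wiener in place of Riemann–Lebesgue), INFINITE atom sets
(unbounded per line, or accumulating: the exposed-pair step at an accumulation point = LINE 1's price R2, shared), tameness of the free
data `a, β_z` (existence of `lim a_z`). -/
theorem stub_stringShellsTH :
    ∀ (C : ℝ) (v : ℝ → EuclideanSpace ℝ (Fin 3) → EuclideanSpace ℝ (Fin 3)),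
      Literature.Analysis.FluidPDE.HasTypeITimeDecay C v →
      ContinuousOn (Function.uncurry v) (Set.Iio (0 : ℝ) ×ˢ Set.univ) →
      (∀ s t : ℝ, s < t → t < 0 → ∀ x, v t x =
        Literature.Analysis.UnboundedOperators.heatExtension (v s) (t - s) x -
          Literature.Analysis.FluidPDE.oseenDuhamel 1 s v v t x) →
      (∀ t < 0, Literature.Analysis.FluidPDE.VectorCalculus.IsDivFree (v t)) →
      (∀ s < 0, ∀ y, ⟪Literature.Analysis.FluidPDE.curl (v s) y, EuclideanSpace.single 2 1⟫_ℝ = 0) →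
      ∀ W : Set (ℝ × EuclideanSpace ℝ (Fin 3)), IsOpen W → W.Nonempty → W ⊆ Set.Iio (0 : ℝ) ×ˢ Set.univ →
        (∀ z ∈ W, Literature.Analysis.FluidPDE.curl (v z.1) z.2 ≠ 0 ∧
          (fderiv ℝ (v z.1) z.2 (EuclideanSpace.single 0 1) 2 ≠ 0 ∨ fderiv ℝ (v z.1) z.2 (EuclideanSpace.single 1 1) 2 ≠ 0) ∧
          (fderiv ℝ (v z.1) z.2 (EuclideanSpace.single 2 1) 0 ≠ 0 ∨ fderiv ℝ (v z.1) z.2 (EuclideanSpace.single 2 1) 1 ≠ 0)) →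
        (∀ m : ℝ → ℝ, ∀ W₁ : Set (ℝ × EuclideanSpace ℝ (Fin 3)), W₁ ⊆ W → IsOpen W₁ → W₁.Nonempty →
          ∃ z ∈ W₁, ∃ b : Fin 3, b ≠ 2 ∧
            fderiv ℝ (v z.1) z.2 (EuclideanSpace.single 2 1) b ≠
              m z.1 * fderiv ℝ (v z.1) z.2 (EuclideanSpace.single b 1) 2) →
        (∀ z ∈ W,
          fderiv ℝ (fun x => fderiv ℝ (v z.1) x (EuclideanSpace.single 2 1) 2) z.2 (EuclideanSpace.single 0 1) *
              fderiv ℝ (v z.1) z.2 (EuclideanSpace.single 1 1) 2 -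
            fderiv ℝ (fun x => fderiv ℝ (v z.1) x (EuclideanSpace.single 2 1) 2) z.2 (EuclideanSpace.single 1 1) *
              fderiv ℝ (v z.1) z.2 (EuclideanSpace.single 0 1) 2 ≠ 0) →
        (∀ z ∈ W,
          fderiv ℝ (v z.1) z.2 (EuclideanSpace.single 2 1) 0 * fderiv ℝ (v z.1) z.2 (EuclideanSpace.single 0 1) 2 +
            fderiv ℝ (v z.1) z.2 (EuclideanSpace.single 2 1) 1 * fderiv ℝ (v z.1) z.2 (EuclideanSpace.single 1 1) 2 < 0) →
        (∃ m : ℝ → ℝ → ℝ, ∀ z ∈ W, ∀ b : Fin 3, b ≠ 2 →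
          fderiv ℝ (v z.1) z.2 (EuclideanSpace.single 2 1) b =
            m z.1 (z.2 2) * fderiv ℝ (v z.1) z.2 (EuclideanSpace.single b 1) 2) →
        (∀ s : ℝ, s < 0 → ∀ y y' : EuclideanSpace ℝ (Fin 3), y 2 = y' 2 → ∀ b b' : Fin 3, b ≠ 2 → b' ≠ 2 →
          fderiv ℝ (v s) y (EuclideanSpace.single 2 1) b * fderiv ℝ (v s) y' (EuclideanSpace.single b' 1) 2 =
            fderiv ℝ (v s) y' (EuclideanSpace.single 2 1) b' * fderiv ℝ (v s) y (EuclideanSpace.single b 1) 2) →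
        (∀ z ∈ W, ∀ h : ℝ, ∃ x : EuclideanSpace ℝ (Fin 3), x 2 = h ∧
          fderiv ℝ (v z.1) x (EuclideanSpace.single 2 1) 0 * fderiv ℝ (v z.1) x (EuclideanSpace.single 0 1) 2 +
            fderiv ℝ (v z.1) x (EuclideanSpace.single 2 1) 1 * fderiv ℝ (v z.1) x (EuclideanSpace.single 1 1) 2 < 0) →
        ¬ Literature.Analysis.FluidPDE.IsBackwardSingularPoint v 0 := by
  sorry

/-- **STUB (`stub_turningHeightTH`) — the TURNING-PLANE / mixed-type residue (open, width 0; = census D9 Sub_S transposed to the (TH)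
column).**  Binders of `stub_hyperbolicTH` verbatim + the global ratio law + «at some window time some height `h` carries NO strictly
hyperbolic point»: by the ratio law that plane is TURNING (`∂_z v_h ≡ 0`, hence `w_zz ≡ 0` on it, and the horizontal momentum equation
restricted to it is forced 2-D Navier–Stokes), FLAT (`∇ₕw ≡ 0` on it: a horizontally-flat height, cf. tree `…HorizontalFlatPast` which
needs flatness on a WINDOW of heights, not one plane), or ELLIPTIC (`m(t,h) > 0`: the string equation becomes `Y'' = |ξ|² m Y`, bounded
modes on an elliptic END are the decaying branch only — a Dirichlet-to-Neumann PHASE LOCKING `ŵ₁ = k(|ξ|)ŵ₀` of all modes, and Theorem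
A's convex functional `q(z) = ∫|w∗φ_ε|² ρ` is convex on every elliptic height interval).  What is missing: a mechanism at an interior
turning plane (Airy layer) and for finite elliptic intervals; Theorem A (tree `…ThmASemiEllipticThick` / K2-p2) needs ellipticity at
EVERY height.  Why it might fail: it is the whole mixed-type-in-height sub-column with no tool of record; filed so that the split of
the (TH) column by global height type is exhaustive and typed. -/
theorem stub_turningHeightTH :
    ∀ (C : ℝ) (v : ℝ → EuclideanSpace ℝ (Fin 3) → EuclideanSpace ℝ (Fin 3)),
      Literature.Analysis.FluidPDE.HasTypeITimeDecay C v →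
      ContinuousOn (Function.uncurry v) (Set.Iio (0 : ℝ) ×ˢ Set.univ) →
      (∀ s t : ℝ, s < t → t < 0 → ∀ x, v t x =
        Literature.Analysis.UnboundedOperators.heatExtension (v s) (t - s) x -
          Literature.Analysis.FluidPDE.oseenDuhamel 1 s v v t x) →
      (∀ t < 0, Literature.Analysis.FluidPDE.VectorCalculus.IsDivFree (v t)) →
      (∀ s < 0, ∀ y, ⟪Literature.Analysis.FluidPDE.curl (v s) y, EuclideanSpace.single 2 1⟫_ℝ = 0) →
      ∀ W : Set (ℝ × EuclideanSpace ℝ (Fin 3)), IsOpen W → W.Nonempty → W ⊆ Set.Iio (0 : ℝ) ×ˢ Set.univ →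
        (∀ z ∈ W, Literature.Analysis.FluidPDE.curl (v z.1) z.2 ≠ 0 ∧
          (fderiv ℝ (v z.1) z.2 (EuclideanSpace.single 0 1) 2 ≠ 0 ∨ fderiv ℝ (v z.1) z.2 (EuclideanSpace.single 1 1) 2 ≠ 0) ∧
          (fderiv ℝ (v z.1) z.2 (EuclideanSpace.single 2 1) 0 ≠ 0 ∨ fderiv ℝ (v z.1) z.2 (EuclideanSpace.single 2 1) 1 ≠ 0)) →
        (∀ m : ℝ → ℝ, ∀ W₁ : Set (ℝ × EuclideanSpace ℝ (Fin 3)), W₁ ⊆ W → IsOpen W₁ → W₁.Nonempty →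
          ∃ z ∈ W₁, ∃ b : Fin 3, b ≠ 2 ∧
            fderiv ℝ (v z.1) z.2 (EuclideanSpace.single 2 1) b ≠
              m z.1 * fderiv ℝ (v z.1) z.2 (EuclideanSpace.single b 1) 2) →
        (∀ z ∈ W,
          fderiv ℝ (fun x => fderiv ℝ (v z.1) x (EuclideanSpace.single 2 1) 2) z.2 (EuclideanSpace.single 0 1) *
              fderiv ℝ (v z.1) z.2 (EuclideanSpace.single 1 1) 2 -
            fderiv ℝ (fun x => fderiv ℝ (v z.1) x (EuclideanSpace.single 2 1) 2) z.2 (EuclideanSpace.single 1 1) *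
              fderiv ℝ (v z.1) z.2 (EuclideanSpace.single 0 1) 2 ≠ 0) →
        (∀ z ∈ W,
          fderiv ℝ (v z.1) z.2 (EuclideanSpace.single 2 1) 0 * fderiv ℝ (v z.1) z.2 (EuclideanSpace.single 0 1) 2 +
            fderiv ℝ (v z.1) z.2 (EuclideanSpace.single 2 1) 1 * fderiv ℝ (v z.1) z.2 (EuclideanSpace.single 1 1) 2 < 0) →
        (∃ m : ℝ → ℝ → ℝ, ∀ z ∈ W, ∀ b : Fin 3, b ≠ 2 →
          fderiv ℝ (v z.1) z.2 (EuclideanSpace.single 2 1) b =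
            m z.1 (z.2 2) * fderiv ℝ (v z.1) z.2 (EuclideanSpace.single b 1) 2) →
        (∀ s : ℝ, s < 0 → ∀ y y' : EuclideanSpace ℝ (Fin 3), y 2 = y' 2 → ∀ b b' : Fin 3, b ≠ 2 → b' ≠ 2 →
          fderiv ℝ (v s) y (EuclideanSpace.single 2 1) b * fderiv ℝ (v s) y' (EuclideanSpace.single b' 1) 2 =
            fderiv ℝ (v s) y' (EuclideanSpace.single 2 1) b' * fderiv ℝ (v s) y (EuclideanSpace.single b 1) 2) →
        (∃ z ∈ W, ∃ h : ℝ, ∀ x : EuclideanSpace ℝ (Fin 3), x 2 = h →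
          0 ≤ fderiv ℝ (v z.1) x (EuclideanSpace.single 2 1) 0 * fderiv ℝ (v z.1) x (EuclideanSpace.single 0 1) 2 +
            fderiv ℝ (v z.1) x (EuclideanSpace.single 2 1) 1 * fderiv ℝ (v z.1) x (EuclideanSpace.single 1 1) 2) →
        ¬ Literature.Analysis.FluidPDE.IsBackwardSingularPoint v 0 := by
  sorry

/-- **STUB (`stub_hyperbolicThick`) — SHARED VERBATIM with `Lines/mixed_type.lean` (K2-p2 g6): hyperbolic THICK twisting windows are
regular.**  This line does not re-cut the thick columns; the statement is restated (class binders + poloidality + the `hHT` shape of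
`…ThmAThreeStubs.twisting_regular_of_three`) only so that the composition below is self-contained.  Status, disproof ledger and census:
as recorded for `mixed_type` (`hyperbolicThick_false_without_mild`: (M) load-bearing; STRATEGY-CENSUS g3/g5/g6).  Why it might fail:
it is the THICK wall (no structure function of `(t,z)` alone, no horizontal Fourier side). -/
theorem stub_hyperbolicThick :
    ∀ (C : ℝ) (v : ℝ → EuclideanSpace ℝ (Fin 3) → EuclideanSpace ℝ (Fin 3)),
      Literature.Analysis.FluidPDE.HasTypeITimeDecay C v →
      ContinuousOn (Function.uncurry v) (Set.Iio (0 : ℝ) ×ˢ Set.univ) →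
      (∀ s t : ℝ, s < t → t < 0 → ∀ x, v t x =
        Literature.Analysis.UnboundedOperators.heatExtension (v s) (t - s) x -
          Literature.Analysis.FluidPDE.oseenDuhamel 1 s v v t x) →
      (∀ t < 0, Literature.Analysis.FluidPDE.VectorCalculus.IsDivFree (v t)) →
      (∀ s < 0, ∀ y, ⟪Literature.Analysis.FluidPDE.curl (v s) y, EuclideanSpace.single 2 1⟫_ℝ = 0) →
      ∀ W : Set (ℝ × EuclideanSpace ℝ (Fin 3)), IsOpen W → W.Nonempty → W ⊆ Set.Iio (0 : ℝ) ×ˢ Set.univ →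
        (∀ z ∈ W, Literature.Analysis.FluidPDE.curl (v z.1) z.2 ≠ 0 ∧
          (fderiv ℝ (v z.1) z.2 (EuclideanSpace.single 0 1) 2 ≠ 0 ∨ fderiv ℝ (v z.1) z.2 (EuclideanSpace.single 1 1) 2 ≠ 0) ∧
          (fderiv ℝ (v z.1) z.2 (EuclideanSpace.single 2 1) 0 ≠ 0 ∨ fderiv ℝ (v z.1) z.2 (EuclideanSpace.single 2 1) 1 ≠ 0)) →
        (∀ m : ℝ → ℝ, ∀ W₁ : Set (ℝ × EuclideanSpace ℝ (Fin 3)), W₁ ⊆ W → IsOpen W₁ → W₁.Nonempty →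
          ∃ z ∈ W₁, ∃ b : Fin 3, b ≠ 2 ∧
            fderiv ℝ (v z.1) z.2 (EuclideanSpace.single 2 1) b ≠
              m z.1 * fderiv ℝ (v z.1) z.2 (EuclideanSpace.single b 1) 2) →
        (∀ z ∈ W,
          fderiv ℝ (fun x => fderiv ℝ (v z.1) x (EuclideanSpace.single 2 1) 2) z.2 (EuclideanSpace.single 0 1) *
              fderiv ℝ (v z.1) z.2 (EuclideanSpace.single 1 1) 2 -
            fderiv ℝ (fun x => fderiv ℝ (v z.1) x (EuclideanSpace.single 2 1) 2) z.2 (EuclideanSpace.single 1 1) *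
              fderiv ℝ (v z.1) z.2 (EuclideanSpace.single 0 1) 2 ≠ 0) →
        (∀ z ∈ W,
          fderiv ℝ (v z.1) z.2 (EuclideanSpace.single 2 1) 0 * fderiv ℝ (v z.1) z.2 (EuclideanSpace.single 0 1) 2 +
            fderiv ℝ (v z.1) z.2 (EuclideanSpace.single 2 1) 1 * fderiv ℝ (v z.1) z.2 (EuclideanSpace.single 1 1) 2 < 0) →
        (∀ m : ℝ → ℝ → ℝ, ∀ W₁ : Set (ℝ × EuclideanSpace ℝ (Fin 3)), W₁ ⊆ W → IsOpen W₁ → W₁.Nonempty →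
          ∃ z ∈ W₁, ∃ b : Fin 3, b ≠ 2 ∧
            fderiv ℝ (v z.1) z.2 (EuclideanSpace.single 2 1) b ≠
              m z.1 (z.2 2) * fderiv ℝ (v z.1) z.2 (EuclideanSpace.single b 1) 2) →
        ¬ Literature.Analysis.FluidPDE.IsBackwardSingularPoint v 0 := by
  sorry

/-- **STUB (`stub_semiEllipticThick`) — SHARED VERBATIM with `Lines/mixed_type.lean`: twisting THICK windows inside a semi-elliptic
slab are regular** (class binders + poloidality + the `hST` shape of `…twisting_regular_of_three`).  Status as for `mixed_type`
(`semiEllipticThick_false_without_mild`; Theorem A's convexity handles the (TH) semi-elliptic slab, tree `…ThmASemiEllipticThick`, not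
the thick one).  Why it might fail: the THICK wall, elliptic side. -/
theorem stub_semiEllipticThick :
    ∀ (C : ℝ) (v : ℝ → EuclideanSpace ℝ (Fin 3) → EuclideanSpace ℝ (Fin 3)),
      Literature.Analysis.FluidPDE.HasTypeITimeDecay C v →
      ContinuousOn (Function.uncurry v) (Set.Iio (0 : ℝ) ×ˢ Set.univ) →
      (∀ s t : ℝ, s < t → t < 0 → ∀ x, v t x =
        Literature.Analysis.UnboundedOperators.heatExtension (v s) (t - s) x -
          Literature.Analysis.FluidPDE.oseenDuhamel 1 s v v t x) →
      (∀ t < 0, Literature.Analysis.FluidPDE.VectorCalculus.IsDivFree (v t)) →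
      (∀ s < 0, ∀ y, ⟪Literature.Analysis.FluidPDE.curl (v s) y, EuclideanSpace.single 2 1⟫_ℝ = 0) →
      ∀ W : Set (ℝ × EuclideanSpace ℝ (Fin 3)), IsOpen W → W.Nonempty → W ⊆ Set.Iio (0 : ℝ) ×ˢ Set.univ →
        (∀ z ∈ W, Literature.Analysis.FluidPDE.curl (v z.1) z.2 ≠ 0 ∧
          (fderiv ℝ (v z.1) z.2 (EuclideanSpace.single 0 1) 2 ≠ 0 ∨ fderiv ℝ (v z.1) z.2 (EuclideanSpace.single 1 1) 2 ≠ 0) ∧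
          (fderiv ℝ (v z.1) z.2 (EuclideanSpace.single 2 1) 0 ≠ 0 ∨ fderiv ℝ (v z.1) z.2 (EuclideanSpace.single 2 1) 1 ≠ 0)) →
        (∀ m : ℝ → ℝ, ∀ W₁ : Set (ℝ × EuclideanSpace ℝ (Fin 3)), W₁ ⊆ W → IsOpen W₁ → W₁.Nonempty →
          ∃ z ∈ W₁, ∃ b : Fin 3, b ≠ 2 ∧
            fderiv ℝ (v z.1) z.2 (EuclideanSpace.single 2 1) b ≠
              m z.1 * fderiv ℝ (v z.1) z.2 (EuclideanSpace.single b 1) 2) →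
        (∀ z ∈ W,
          fderiv ℝ (fun x => fderiv ℝ (v z.1) x (EuclideanSpace.single 2 1) 2) z.2 (EuclideanSpace.single 0 1) *
              fderiv ℝ (v z.1) z.2 (EuclideanSpace.single 1 1) 2 -
            fderiv ℝ (fun x => fderiv ℝ (v z.1) x (EuclideanSpace.single 2 1) 2) z.2 (EuclideanSpace.single 1 1) *
              fderiv ℝ (v z.1) z.2 (EuclideanSpace.single 0 1) 2 ≠ 0) →
        ∀ a b : ℝ, W ⊆ Set.Ioo a b ×ˢ Set.univ →
          (∀ s ∈ Set.Ioo a b, ∀ y : EuclideanSpace ℝ (Fin 3),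
            0 ≤ fderiv ℝ (v s) y (EuclideanSpace.single 2 1) 0 * fderiv ℝ (v s) y (EuclideanSpace.single 0 1) 2 +
              fderiv ℝ (v s) y (EuclideanSpace.single 2 1) 1 * fderiv ℝ (v s) y (EuclideanSpace.single 1 1) 2) →
          (∀ m : ℝ → ℝ → ℝ, ∀ W₁ : Set (ℝ × EuclideanSpace ℝ (Fin 3)), W₁ ⊆ W → IsOpen W₁ → W₁.Nonempty →
          ∃ z ∈ W₁, ∃ b : Fin 3, b ≠ 2 ∧
            fderiv ℝ (v z.1) z.2 (EuclideanSpace.single 2 1) b ≠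
              m z.1 (z.2 2) * fderiv ℝ (v z.1) z.2 (EuclideanSpace.single b 1) 2) →
          ¬ Literature.Analysis.FluidPDE.IsBackwardSingularPoint v 0 := by
  sorry

/-! ### Composition, step 1 (proved): the hyperbolic (TH) column from the global law + the height-type split; then `stub_twisting` -/

/-- **The hyperbolic (TH) column (`hH` of `twisting_regular_of_three`, = `mixed_type`'s `stub_hyperbolicTH`) PROVED from
`stub_thGlobalLaw`, `stub_stringShellsTH`, `stub_turningHeightTH`**: continue the slope law globally, then split on whether some height
at some window time carries no strictly hyperbolic point. -/
theorem hyperbolicTH_of_heightProfile :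
    ∀ (C : ℝ) (v : ℝ → EuclideanSpace ℝ (Fin 3) → EuclideanSpace ℝ (Fin 3)),
      Literature.Analysis.FluidPDE.HasTypeITimeDecay C v →
      ContinuousOn (Function.uncurry v) (Set.Iio (0 : ℝ) ×ˢ Set.univ) →
      (∀ s t : ℝ, s < t → t < 0 → ∀ x, v t x =
        Literature.Analysis.UnboundedOperators.heatExtension (v s) (t - s) x -
          Literature.Analysis.FluidPDE.oseenDuhamel 1 s v v t x) →
      (∀ t < 0, Literature.Analysis.FluidPDE.VectorCalculus.IsDivFree (v t)) →
      (∀ s < 0, ∀ y, ⟪Literature.Analysis.FluidPDE.curl (v s) y, EuclideanSpace.single 2 1⟫_ℝ = 0) →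
      ∀ W : Set (ℝ × EuclideanSpace ℝ (Fin 3)), IsOpen W → W.Nonempty → W ⊆ Set.Iio (0 : ℝ) ×ˢ Set.univ →
        (∀ z ∈ W, Literature.Analysis.FluidPDE.curl (v z.1) z.2 ≠ 0 ∧
          (fderiv ℝ (v z.1) z.2 (EuclideanSpace.single 0 1) 2 ≠ 0 ∨ fderiv ℝ (v z.1) z.2 (EuclideanSpace.single 1 1) 2 ≠ 0) ∧
          (fderiv ℝ (v z.1) z.2 (EuclideanSpace.single 2 1) 0 ≠ 0 ∨ fderiv ℝ (v z.1) z.2 (EuclideanSpace.single 2 1) 1 ≠ 0)) →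
        (∀ m : ℝ → ℝ, ∀ W₁ : Set (ℝ × EuclideanSpace ℝ (Fin 3)), W₁ ⊆ W → IsOpen W₁ → W₁.Nonempty →
          ∃ z ∈ W₁, ∃ b : Fin 3, b ≠ 2 ∧
            fderiv ℝ (v z.1) z.2 (EuclideanSpace.single 2 1) b ≠
              m z.1 * fderiv ℝ (v z.1) z.2 (EuclideanSpace.single b 1) 2) →
        (∀ z ∈ W,
          fderiv ℝ (fun x => fderiv ℝ (v z.1) x (EuclideanSpace.single 2 1) 2) z.2 (EuclideanSpace.single 0 1) *
              fderiv ℝ (v z.1) z.2 (EuclideanSpace.single 1 1) 2 -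
            fderiv ℝ (fun x => fderiv ℝ (v z.1) x (EuclideanSpace.single 2 1) 2) z.2 (EuclideanSpace.single 1 1) *
              fderiv ℝ (v z.1) z.2 (EuclideanSpace.single 0 1) 2 ≠ 0) →
        (∀ z ∈ W,
          fderiv ℝ (v z.1) z.2 (EuclideanSpace.single 2 1) 0 * fderiv ℝ (v z.1) z.2 (EuclideanSpace.single 0 1) 2 +
            fderiv ℝ (v z.1) z.2 (EuclideanSpace.single 2 1) 1 * fderiv ℝ (v z.1) z.2 (EuclideanSpace.single 1 1) 2 < 0) →
        (∃ m : ℝ → ℝ → ℝ, ∀ z ∈ W, ∀ b : Fin 3, b ≠ 2 →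
          fderiv ℝ (v z.1) z.2 (EuclideanSpace.single 2 1) b =
            m z.1 (z.2 2) * fderiv ℝ (v z.1) z.2 (EuclideanSpace.single b 1) 2) →
        ¬ Literature.Analysis.FluidPDE.IsBackwardSingularPoint v 0 := by
  intro C v hrate hcont hmild hdiv hpol W hW hWne hWs hnd hpin htw hhyp hTH
  have hlaw := stub_thGlobalLaw C v hrate hcont hmild hdiv W hW hWne hWs hTH
  by_cases hNH : ∃ z ∈ W, ∃ h : ℝ, ∀ x : EuclideanSpace ℝ (Fin 3), x 2 = h →
      0 ≤ fderiv ℝ (v z.1) x (EuclideanSpace.single 2 1) 0 * fderiv ℝ (v z.1) x (EuclideanSpace.single 0 1) 2 +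
        fderiv ℝ (v z.1) x (EuclideanSpace.single 2 1) 1 * fderiv ℝ (v z.1) x (EuclideanSpace.single 1 1) 2
  · exact stub_turningHeightTH C v hrate hcont hmild hdiv hpol W hW hWne hWs hnd hpin htw hhyp hTH hlaw hNH
  · push_neg at hNH
    exact stub_stringShellsTH C v hrate hcont hmild hdiv hpol W hW hWne hWs hnd hpin htw hhyp hTH hlaw hNH

/-- **THE RUNG IS A SPECIAL CASE OF THE LINE (proved)**: `stub_shortStringTH` follows from the three (TH) stubs — its binders contain
those of the (TH) column. -/
theorem shortStringTH_of_line :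
    ∀ (C : ℝ) (v : ℝ → EuclideanSpace ℝ (Fin 3) → EuclideanSpace ℝ (Fin 3)),
      Literature.Analysis.FluidPDE.HasTypeITimeDecay C v →
      ContinuousOn (Function.uncurry v) (Set.Iio (0 : ℝ) ×ˢ Set.univ) →
      (∀ s t : ℝ, s < t → t < 0 → ∀ x, v t x =
        Literature.Analysis.UnboundedOperators.heatExtension (v s) (t - s) x -
          Literature.Analysis.FluidPDE.oseenDuhamel 1 s v v t x) →
      (∀ t < 0, Literature.Analysis.FluidPDE.VectorCalculus.IsDivFree (v t)) →
      (∀ s < 0, ∀ y, ⟪Literature.Analysis.FluidPDE.curl (v s) y, EuclideanSpace.single 2 1⟫_ℝ = 0) →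
      ∀ W : Set (ℝ × EuclideanSpace ℝ (Fin 3)), IsOpen W → W.Nonempty → W ⊆ Set.Iio (0 : ℝ) ×ˢ Set.univ →
        (∀ z ∈ W, Literature.Analysis.FluidPDE.curl (v z.1) z.2 ≠ 0 ∧
          (fderiv ℝ (v z.1) z.2 (EuclideanSpace.single 0 1) 2 ≠ 0 ∨ fderiv ℝ (v z.1) z.2 (EuclideanSpace.single 1 1) 2 ≠ 0) ∧
          (fderiv ℝ (v z.1) z.2 (EuclideanSpace.single 2 1) 0 ≠ 0 ∨ fderiv ℝ (v z.1) z.2 (EuclideanSpace.single 2 1) 1 ≠ 0)) →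
        (∀ m : ℝ → ℝ, ∀ W₁ : Set (ℝ × EuclideanSpace ℝ (Fin 3)), W₁ ⊆ W → IsOpen W₁ → W₁.Nonempty →
          ∃ z ∈ W₁, ∃ b : Fin 3, b ≠ 2 ∧
            fderiv ℝ (v z.1) z.2 (EuclideanSpace.single 2 1) b ≠
              m z.1 * fderiv ℝ (v z.1) z.2 (EuclideanSpace.single b 1) 2) →
        (∀ z ∈ W,
          fderiv ℝ (fun x => fderiv ℝ (v z.1) x (EuclideanSpace.single 2 1) 2) z.2 (EuclideanSpace.single 0 1) *
              fderiv ℝ (v z.1) z.2 (EuclideanSpace.single 1 1) 2 -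
            fderiv ℝ (fun x => fderiv ℝ (v z.1) x (EuclideanSpace.single 2 1) 2) z.2 (EuclideanSpace.single 1 1) *
              fderiv ℝ (v z.1) z.2 (EuclideanSpace.single 0 1) 2 ≠ 0) →
        (∀ z ∈ W,
          fderiv ℝ (v z.1) z.2 (EuclideanSpace.single 2 1) 0 * fderiv ℝ (v z.1) z.2 (EuclideanSpace.single 0 1) 2 +
            fderiv ℝ (v z.1) z.2 (EuclideanSpace.single 2 1) 1 * fderiv ℝ (v z.1) z.2 (EuclideanSpace.single 1 1) 2 < 0) →
        (∃ m : ℝ → ℝ → ℝ, ∀ z ∈ W, ∀ b : Fin 3, b ≠ 2 →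
          fderiv ℝ (v z.1) z.2 (EuclideanSpace.single 2 1) b =
            m z.1 (z.2 2) * fderiv ℝ (v z.1) z.2 (EuclideanSpace.single b 1) 2) →
        (∃ m : ℝ → ℝ → ℝ,
          (∀ s : ℝ, s < 0 → ∀ y : EuclideanSpace ℝ (Fin 3), ∀ b : Fin 3, b ≠ 2 →
            fderiv ℝ (v s) y (EuclideanSpace.single 2 1) b = m s (y 2) * fderiv ℝ (v s) y (EuclideanSpace.single b 1) 2) ∧
          (∀ s : ℝ, s < 0 → MeasureTheory.IntegrableOn (fun h : ℝ => (1 + |h|) * m s h) (Set.Ioi (0 : ℝ)))) →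
        ¬ Literature.Analysis.FluidPDE.IsBackwardSingularPoint v 0 := by
  intro C v hrate hcont hmild hdiv hpol W hW hWne hWs hnd hpin htw hhyp hTH _hshort
  exact hyperbolicTH_of_heightProfile C v hrate hcont hmild hdiv hpol W hW hWne hWs hnd hpin htw hhyp hTH

/-- **NON-DEGENERATE + PIN + TWISTING ⇒ regular** — VERBATIM the statement of the registered stub `stub_twisting` of
`Lines/lrc_jet.lean` v5 (= `mixed_type`'s `twisting_of_mixedType`), PROVED: `hH` from `hyperbolicTH_of_heightProfile`, `hHT`/`hST`
from the shared thick stubs. -/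
theorem twisting_of_stringShells :
    ∀ (C : ℝ) (v : ℝ → EuclideanSpace ℝ (Fin 3) → EuclideanSpace ℝ (Fin 3)),
      Literature.Analysis.FluidPDE.HasTypeITimeDecay C v →
      ContinuousOn (Function.uncurry v) (Set.Iio (0 : ℝ) ×ˢ Set.univ) →
      (∀ s t : ℝ, s < t → t < 0 → ∀ x, v t x =
        Literature.Analysis.UnboundedOperators.heatExtension (v s) (t - s) x -
          Literature.Analysis.FluidPDE.oseenDuhamel 1 s v v t x) →
      (∀ t < 0, Literature.Analysis.FluidPDE.VectorCalculus.IsDivFree (v t)) →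
      (∀ s < 0, ∀ y, ⟪Literature.Analysis.FluidPDE.curl (v s) y, EuclideanSpace.single 2 1⟫_ℝ = 0) →
      ∀ W : Set (ℝ × EuclideanSpace ℝ (Fin 3)), IsOpen W → W.Nonempty → W ⊆ Set.Iio (0 : ℝ) ×ˢ Set.univ →
        (∀ z ∈ W, Literature.Analysis.FluidPDE.curl (v z.1) z.2 ≠ 0 ∧
          (fderiv ℝ (v z.1) z.2 (EuclideanSpace.single 0 1) 2 ≠ 0 ∨ fderiv ℝ (v z.1) z.2 (EuclideanSpace.single 1 1) 2 ≠ 0) ∧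
          (fderiv ℝ (v z.1) z.2 (EuclideanSpace.single 2 1) 0 ≠ 0 ∨ fderiv ℝ (v z.1) z.2 (EuclideanSpace.single 2 1) 1 ≠ 0)) →
        (∀ m : ℝ → ℝ, ∀ W₁ : Set (ℝ × EuclideanSpace ℝ (Fin 3)), W₁ ⊆ W → IsOpen W₁ → W₁.Nonempty →
          ∃ z ∈ W₁, ∃ b : Fin 3, b ≠ 2 ∧
            fderiv ℝ (v z.1) z.2 (EuclideanSpace.single 2 1) b ≠
              m z.1 * fderiv ℝ (v z.1) z.2 (EuclideanSpace.single b 1) 2) →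
        (∀ z ∈ W,
          fderiv ℝ (fun x => fderiv ℝ (v z.1) x (EuclideanSpace.single 2 1) 2) z.2 (EuclideanSpace.single 0 1) *
              fderiv ℝ (v z.1) z.2 (EuclideanSpace.single 1 1) 2 -
            fderiv ℝ (fun x => fderiv ℝ (v z.1) x (EuclideanSpace.single 2 1) 2) z.2 (EuclideanSpace.single 1 1) *
              fderiv ℝ (v z.1) z.2 (EuclideanSpace.single 0 1) 2 ≠ 0) →
        ¬ Literature.Analysis.FluidPDE.IsBackwardSingularPoint v 0 := by
  intro C v hrate hcont hmild hdiv hpol W hW hWne hWs hnd hpin htw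
  refine twisting_regular_of_three C v hrate hcont hmild hdiv ?_ ?_ ?_ W hW hWne hWs hnd hpin htw
  · -- hH : hyperbolic (TH) windows
    intro W' hW' hW'ne hW's hnd' hpin' htw' hhyp' hTH'
    exact hyperbolicTH_of_heightProfile C v hrate hcont hmild hdiv hpol W' hW' hW'ne hW's hnd' hpin' htw' hhyp' hTH'
  · -- hHT : hyperbolic thick windows (shared stub)
    intro W' hW' hW'ne hW's hnd' hpin' htw' hhyp' hth'
    exact stub_hyperbolicThick C v hrate hcont hmild hdiv hpol W' hW' hW'ne hW's hnd' hpin' htw' hhyp' hth'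
  · -- hST : twisting thick windows inside a semi-elliptic slab (shared stub)
    intro W' hW' hW'ne hW's hnd' hpin' htw' a b hWab hsemi hth'
    exact stub_semiEllipticThick C v hrate hcont hmild hdiv hpol W' hW' hW'ne hW's hnd' hpin' htw' a b hWab hsemi hth'

/-! ### Composition, step 2 (proved, = `mixed_type` v2 / `lrc_jet` v5 chain): the crux -/

/-- **NON-DEGENERATE + PIN ⇒ regular** — the pointwise twist dichotomy over the tree theorem `…StubUntwisted.stub_untwisted`
(p561151, the untwisted half) and `twisting_of_stringShells` (the twisting half). -/
theorem ndRegular :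
    ∀ (C : ℝ) (v : ℝ → EuclideanSpace ℝ (Fin 3) → EuclideanSpace ℝ (Fin 3)),
      Literature.Analysis.FluidPDE.HasTypeITimeDecay C v →
      ContinuousOn (Function.uncurry v) (Set.Iio (0 : ℝ) ×ˢ Set.univ) →
      (∀ s t : ℝ, s < t → t < 0 → ∀ x, v t x =
        Literature.Analysis.UnboundedOperators.heatExtension (v s) (t - s) x -
          Literature.Analysis.FluidPDE.oseenDuhamel 1 s v v t x) →
      (∀ t < 0, Literature.Analysis.FluidPDE.VectorCalculus.IsDivFree (v t)) →
      (∀ s < 0, ∀ y, ⟪Literature.Analysis.FluidPDE.curl (v s) y, EuclideanSpace.single 2 1⟫_ℝ = 0) →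
      ∀ W : Set (ℝ × EuclideanSpace ℝ (Fin 3)), IsOpen W → W.Nonempty → W ⊆ Set.Iio (0 : ℝ) ×ˢ Set.univ →
        (∀ z ∈ W, Literature.Analysis.FluidPDE.curl (v z.1) z.2 ≠ 0 ∧
          (fderiv ℝ (v z.1) z.2 (EuclideanSpace.single 0 1) 2 ≠ 0 ∨ fderiv ℝ (v z.1) z.2 (EuclideanSpace.single 1 1) 2 ≠ 0) ∧
          (fderiv ℝ (v z.1) z.2 (EuclideanSpace.single 2 1) 0 ≠ 0 ∨ fderiv ℝ (v z.1) z.2 (EuclideanSpace.single 2 1) 1 ≠ 0)) →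
        (∀ m : ℝ → ℝ, ∀ W₁ : Set (ℝ × EuclideanSpace ℝ (Fin 3)), W₁ ⊆ W → IsOpen W₁ → W₁.Nonempty →
          ∃ z ∈ W₁, ∃ b : Fin 3, b ≠ 2 ∧
            fderiv ℝ (v z.1) z.2 (EuclideanSpace.single 2 1) b ≠
              m z.1 * fderiv ℝ (v z.1) z.2 (EuclideanSpace.single b 1) 2) →
        ¬ Literature.Analysis.FluidPDE.IsBackwardSingularPoint v 0 := by
  intro C v hrate hcont hmild hdiv hpol W hW hWne hWs hnd hpin
  set T : ℝ × EuclideanSpace ℝ (Fin 3) → ℝ := fun z =>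
    fderiv ℝ (fun x => fderiv ℝ (v z.1) x (EuclideanSpace.single 2 1) 2) z.2 (EuclideanSpace.single 0 1) *
              fderiv ℝ (v z.1) z.2 (EuclideanSpace.single 1 1) 2 -
            fderiv ℝ (fun x => fderiv ℝ (v z.1) x (EuclideanSpace.single 2 1) 2) z.2 (EuclideanSpace.single 1 1) *
              fderiv ℝ (v z.1) z.2 (EuclideanSpace.single 0 1) 2 with hT
  by_cases htw : ∃ z ∈ W, T z ≠ 0
  · obtain ⟨z₀, hz₀W, hz₀⟩ := htw
    have hslab : IsOpen (Set.Iio (0 : ℝ) ×ˢ (Set.univ : Set (EuclideanSpace ℝ (Fin 3)))) :=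
      isOpen_Iio.prod isOpen_univ
    have hTc : ContinuousOn T (Set.Iio (0 : ℝ) ×ˢ Set.univ) := by
      rw [hT]
      exact continuousOn_twist hrate hcont hmild
    have hO : IsOpen ((Set.Iio (0 : ℝ) ×ˢ Set.univ) ∩ T ⁻¹' {0}ᶜ) :=
      hTc.isOpen_inter_preimage hslab isOpen_compl_singleton
    set W₃ : Set (ℝ × EuclideanSpace ℝ (Fin 3)) := W ∩ ((Set.Iio (0 : ℝ) ×ˢ Set.univ) ∩ T ⁻¹' {0}ᶜ) with hW₃
    have hW₃o : IsOpen W₃ := hW.inter hO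
    have hW₃W : W₃ ⊆ W := Set.inter_subset_left
    have hW₃ne : W₃.Nonempty := ⟨z₀, hz₀W, hWs hz₀W, hz₀⟩
    refine twisting_of_stringShells C v hrate hcont hmild hdiv hpol W₃ hW₃o hW₃ne (hW₃W.trans hWs)
      (fun z hz => hnd z (hW₃W hz)) (fun m W₁ hW₁ hW₁o hW₁ne => hpin m W₁ (hW₁.trans hW₃W) hW₁o hW₁ne) ?_
    intro z hz
    exact hz.2.2
  · push Not at htw
    exact Summit.NavierStokesRegularity.NavierStokesRegularity.Theorems.PoloidalWindowDoorPoloidalWindowRigidityStubUntwisted.stub_untwisted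
      C v hrate hcont hmild hdiv hpol W hW hWne hWs hnd htw

/-- **LRC″ with spatial pins, UNDER THE SINGULARITY ASSUMPTION** (vacuously, from `ndRegular`) — the hypothesis `hLRC` of
`…K2OfLrcSpatial.nonflatLiouville_of_lrc_spatial`. -/
theorem lrcSpatial_of_stubs :
    ∀ (C : ℝ) (v : ℝ → EuclideanSpace ℝ (Fin 3) → EuclideanSpace ℝ (Fin 3)),
      Literature.Analysis.FluidPDE.HasTypeITimeDecay C v →
      ContinuousOn (Function.uncurry v) (Set.Iio (0 : ℝ) ×ˢ Set.univ) →
      (∀ s t : ℝ, s < t → t < 0 → ∀ x, v t x =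
        Literature.Analysis.UnboundedOperators.heatExtension (v s) (t - s) x -
          Literature.Analysis.FluidPDE.oseenDuhamel 1 s v v t x) →
      (∀ t < 0, Literature.Analysis.FluidPDE.VectorCalculus.IsDivFree (v t)) →
      (∀ s < 0, ∀ y, ⟪Literature.Analysis.FluidPDE.curl (v s) y, EuclideanSpace.single 2 1⟫_ℝ = 0) →
      Literature.Analysis.FluidPDE.IsBackwardSingularPoint v 0 →
      ∀ W : Set (ℝ × EuclideanSpace ℝ (Fin 3)), IsOpen W → W.Nonempty → W ⊆ Set.Iio (0 : ℝ) ×ˢ Set.univ →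
        (∀ z ∈ W, Literature.Analysis.FluidPDE.curl (v z.1) z.2 ≠ 0 ∧
          (fderiv ℝ (v z.1) z.2 (EuclideanSpace.single 0 1) 2 ≠ 0 ∨ fderiv ℝ (v z.1) z.2 (EuclideanSpace.single 1 1) 2 ≠ 0) ∧
          (fderiv ℝ (v z.1) z.2 (EuclideanSpace.single 2 1) 0 ≠ 0 ∨ fderiv ℝ (v z.1) z.2 (EuclideanSpace.single 2 1) 1 ≠ 0)) →
        (∀ m : ℝ → ℝ, ∀ W₁ : Set (ℝ × EuclideanSpace ℝ (Fin 3)), W₁ ⊆ W → IsOpen W₁ → W₁.Nonempty →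
          ∃ z ∈ W₁, ∃ b : Fin 3, b ≠ 2 ∧
            fderiv ℝ (v z.1) z.2 (EuclideanSpace.single 2 1) b ≠
              m z.1 * fderiv ℝ (v z.1) z.2 (EuclideanSpace.single b 1) 2) →
        ∃ s : ℝ, s < 0 ∧ ∃ U : Set (EuclideanSpace ℝ (Fin 3)), IsOpen U ∧ U.Nonempty ∧
          ((∃ e : EuclideanSpace ℝ (Fin 3), e ≠ 0 ∧ ∀ y ∈ U, fderiv ℝ (Literature.Analysis.FluidPDE.curl (v s)) y e = 0) ∨
           (∃ c : EuclideanSpace ℝ (Fin 3), ∀ y ∈ U,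
              Literature.Analysis.FluidPDE.rotGen (Literature.Analysis.FluidPDE.curl (v s) y) =
                fderiv ℝ (Literature.Analysis.FluidPDE.curl (v s)) y (Literature.Analysis.FluidPDE.rotGen (y - c)))) := by
  intro C v hrate hcont hmild hdiv hpol hsing W hW hWne hWs hnd hpin
  exact absurd hsing (ndRegular C v hrate hcont hmild hdiv hpol W hW hWne hWs hnd hpin)

/-- **(TV) — both halves are tree theorems** (`…TimeShearLiminf.stub_tvLiminf`, p525351, and
`…HorizontalFlatPast.nonflatLiouville_of_timeShear_unbounded`): the hypothesis `hTV` of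
`…K2OfLrcSpatial.nonflatLiouville_of_lrc_spatial`. -/
theorem tv_of_stubs :
    ∀ (C : ℝ) (v : ℝ → EuclideanSpace ℝ (Fin 3) → EuclideanSpace ℝ (Fin 3)),
      Literature.Analysis.FluidPDE.HasTypeITimeDecay C v →
      ContinuousOn (Function.uncurry v) (Set.Iio (0 : ℝ) ×ˢ Set.univ) →
      (∀ s t : ℝ, s < t → t < 0 → ∀ x, v t x =
        Literature.Analysis.UnboundedOperators.heatExtension (v s) (t - s) x -
          Literature.Analysis.FluidPDE.oseenDuhamel 1 s v v t x) →
      (∀ t < 0, Literature.Analysis.FluidPDE.VectorCalculus.IsDivFree (v t)) →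
      (∀ s < 0, ∀ y, ⟪Literature.Analysis.FluidPDE.curl (v s) y, EuclideanSpace.single 2 1⟫_ℝ = 0) →
      ∀ μ : ℝ → ℝ, (∀ s < 0, μ s < 0) → (∀ s < 0, AnalyticAt ℝ μ s) →
        (∃ s₁ s₂ : ℝ, s₁ < 0 ∧ s₂ < 0 ∧ μ s₁ ≠ μ s₂) →
        (∀ s < 0, ∀ y, ∀ b : Fin 3, b ≠ 2 →
          fderiv ℝ (v s) y (EuclideanSpace.single 2 1) b = μ s * fderiv ℝ (v s) y (EuclideanSpace.single b 1) 2) →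
        ¬ Literature.Analysis.FluidPDE.IsBackwardSingularPoint v 0 := by
  intro C v hrate hcont hmild hdiv hpol μ hneg han hnc hslope
  by_cases hB : ∃ M : ℝ, ∀ T : ℝ, ∃ τ < T, -M ≤ μ τ
  · exact Summit.NavierStokesRegularity.NavierStokesRegularity.Theorems.PoloidalWindowDoorPoloidalWindowRigidityTimeShearLiminf.stub_tvLiminf
      C v hrate hcont hmild hdiv hpol μ hneg han hnc hslope hB
  · push Not at hB
    refine nonflatLiouville_of_timeShear_unbounded hrate hcont hmild hdiv hpol hslope fun M => ?_
    obtain ⟨T, hT⟩ := hB M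
    refine ⟨T, fun τ hτ => ?_⟩
    have h1 : μ τ < -M := hT τ hτ
    have h2 : M < -μ τ := by linarith
    exact h2.le.trans (neg_le_abs (μ τ))

/-- **The slice-sharp residue from the stubs** (symmetry/genericity hypotheses unused): class + poloidal ⇒ not backward-singular,
by contradiction through `…K2OfLrcSpatial.nonflatLiouville_of_lrc_spatial`. -/
theorem sliceSharpNonflatLiouville_of_stringShells :
    ∀ (C : ℝ) (v : ℝ → EuclideanSpace ℝ (Fin 3) → EuclideanSpace ℝ (Fin 3)),
      Literature.Analysis.FluidPDE.HasTypeITimeDecay C v →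
      ContinuousOn (Function.uncurry v) (Set.Iio (0 : ℝ) ×ˢ Set.univ) →
      (∀ s t : ℝ, s < t → t < 0 → ∀ x, v t x =
        Literature.Analysis.UnboundedOperators.heatExtension (v s) (t - s) x -
          Literature.Analysis.FluidPDE.oseenDuhamel 1 s v v t x) →
      (∀ t < 0, Literature.Analysis.FluidPDE.VectorCalculus.IsDivFree (v t)) →
      (∀ s < 0, ∀ y, ⟪Literature.Analysis.FluidPDE.curl (v s) y, EuclideanSpace.single 2 1⟫_ℝ = 0) →
      (∀ s < 0, ∀ y, ⟪fderiv ℝ (v s) y (Literature.Analysis.FluidPDE.curl (v s) y), EuclideanSpace.single 2 1⟫_ℝ = 0) →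
      (∀ s < 0, ∀ b : EuclideanSpace ℝ (Fin 3), b ≠ 0 → ∃ y,
        Literature.Analysis.FluidPDE.cross (Literature.Analysis.FluidPDE.curl (v s) y) b ≠ 0) →
      (∀ s < 0, ∃ y, fderiv ℝ (v s) y (EuclideanSpace.single 2 1) 0 ≠ 0 ∨
        fderiv ℝ (v s) y (EuclideanSpace.single 2 1) 1 ≠ 0) →
      (∀ s < 0, ∀ a : EuclideanSpace ℝ (Fin 3), a ≠ 0 → ⟪a, EuclideanSpace.single 2 1⟫_ℝ = 0 →
        ∃ y, ⟪fderiv ℝ (v s) y a, EuclideanSpace.single 2 1⟫_ℝ ≠ 0) →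
      (∀ s < 0, ∀ e : EuclideanSpace ℝ (Fin 3), e ≠ 0 → ∃ (y : EuclideanSpace ℝ (Fin 3)) (l : ℝ), v s (y + l • e) ≠ v s y) →
      (∀ s < 0, ∀ (L : EuclideanSpace ℝ (Fin 3) ≃ₗᵢ[ℝ] EuclideanSpace ℝ (Fin 3)) (c : EuclideanSpace ℝ (Fin 3)),
        ¬ Literature.Analysis.FluidPDE.IsAxisymmetric (fun y => L.symm (v s (L y + c)))) →
      (∃ lam : ℝ, 0 < lam ∧ ∃ s < 0, ∃ y, lam • v (lam ^ 2 * s) (lam • y) ≠ v s y) →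
        ¬ Literature.Analysis.FluidPDE.IsBackwardSingularPoint v 0 := by
  intro C v hrate hcont hmild hdiv hpol _ _ _ _ _ _ _ hsing
  exact nonflatLiouville_of_lrc_spatial hrate hcont hmild hdiv hpol
    (lrcSpatial_of_stubs C v hrate hcont hmild hdiv hpol hsing) (tv_of_stubs C v hrate hcont hmild hdiv hpol) hsing

/-- **COMPOSITION (proved): the crux `PoloidalWindowRigidity` BY NAME from the stubs `stub_thGlobalLaw`, `stub_stringShellsTH`,
`stub_turningHeightTH` ((TH) column) and the shared thick stubs `stub_hyperbolicThick`, `stub_semiEllipticThick`**, via the landed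
reduction `…Sharper.poloidalWindowRigidity_of_sliceSharpNonflatLiouville`.  (The rung `stub_shortStringTH` is outside the cone: it is
implied by the line, `shortStringTH_of_line`.) -/
theorem PoloidalWindowRigidity_of_stringShells :
    Summit.NavierStokesRegularity.NavierStokesRegularity.Theses.PoloidalWindowDoor.PoloidalWindowRigidity :=
  poloidalWindowRigidity_of_sliceSharpNonflatLiouville sliceSharpNonflatLiouville_of_stringShells

end Summit.NavierStokesRegularity.NavierStokesRegularity.Cruxes.PoloidalWindowRigidity.StringShells
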